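import Literature.AlgebraicGeometry.HodgeTheory.HodgeGenericPointOfLociDichotomy
import HarnessLib

/-!
# Hodge-generic points form a comeagre set (Deligne 1972, Prop. 7.5; André 1992, Lemma 4 — the
# "complement of a meager subset" clause), from the analytic dichotomy of Hodge loci

Family `hodge`, layer `Literature/AlgebraicGeometry/HodgeTheory`; proof file (theorems only, no
definition, no named fact). Written by the prover seat `hodge-nonav-prover-Ax` (g11) of the cell
`hodge-nonav` for route `HodgeConjecture/CyclicUnitaryPowers` (crux K1-A, stmt-HodgeConjecture-19544):
the Cattani–Deligne–Kaplan-free, ANALYTIC form of "very general points are Hodge generic".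

`HodgeGenericPointOfLociDichotomy.exists_generic_of_lociDichotomy` proves Deligne's Baire argument in the
form "SOME point `t₀` in the path component of the base point `s` is generic". André (1992, §4 Lemma 4:
"On the (pathwise connected) complement `X̊` of some meager subset of `X`, `G_x` is locally constant")
and Deligne (1972, Prop. 7.5) state more: the non-generic points form a MEAGRE set. The same proof gives
it, and this file records it:

* `isMeagre_nonGeneric_of_lociDichotomy` — abstract form (any cohomologically locally trivial `U`,
  locally path connected and second countable; countably many properties `P i` of rational transports
  satisfying the local "all or nowhere dense" dichotomy): there is a meagre `M ⊆ U` such that EVERY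
  admissible state `(t₀, T₀)` with `t₀ ∉ M` is generic — every `P i` holding at `(t₀, T₀)` holds at every
  `(t, δ, T)`. `M` is the union of the closures of the nowhere-dense loci based at the centres of a
  countable subcover (no Baire hypothesis is needed to STATE meagreness; Baire's theorem is what makes
  the conclusion non-void).

The geometric consequences (the set of non-Hodge-generic points `¬ IsHodgeGenericPoint` of a smooth
projective family over a smooth quasi-projective base is meagre, from the dichotomy and from Griffiths'
holomorphy of the Hodge bundles) are in the companion file `HodgeGenericPointsComeagre` (same seat).

## References

* [Deligne1972WeilK3] P. Deligne, La conjecture de Weil pour les surfaces K3, Invent. Math. 15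
  (1972), Prop. 7.5.
* [Andre1992] Y. André, Mumford–Tate groups of mixed Hodge structures and the theorem of the fixed
  part, Compositio Math. 82 (1992), §4 Lemma 4 (p. 7).
* [Klingler2022HodgeICM] B. Klingler, Hodge theory, between algebraicity and transcendence, ICM 2022,
  §2.6 ("equal to `G` outside of a meagre set").
-/

noncomputable section

open CategoryTheory AlgebraicGeometry
open _root_.Topology _root_.Filter
open Literature.AlgebraicTopology.SingularHomology
open Literature.AlgebraicGeometry.Motives

namespace Literature.AlgebraicGeometry.HodgeTheory

section HodgeTheory

section Generic

variable {𝒳 S : SchemeOver ℂ} (f : 𝒳 ⟶ S) (k : ℕ) {U : Set (ComplexPoints S)}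
  (hU : IsCohomologicallyLocallyTrivialOn f U)

/-- **The non-generic points form a meagre set (Deligne 1972, Prop. 7.5; André 1992, Lemma 4 —
abstract form of the Baire argument).** Let `f : 𝒳 ⟶ S` be cohomologically locally trivial over
`U ⊆ S(ℂ)` in degree `k`, with transport preserving rational classes, `U` locally path connected and
second countable, the rational fibres `Hᵏ(X_t(ℂ); ℚ)` finite-dimensional, and let `P i t T` (`i` in a
countable set) be properties of the rational transports `T : Hᵏ(X_s; ℚ) ≃ Hᵏ(X_t; ℚ)`. HYPOTHESIS (local
analytic dichotomy): every point has arbitrarily small path-connected open neighbourhoods `W` such that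
for every `i`, every base point `x ∈ W` and every admissible state `Tx` at `x`, the locus of points
`t ∈ W` at which `P i` holds for the continuation of `Tx` along paths inside `W` is either all of `W` or
nowhere dense. CONCLUSION: there is a MEAGRE `M ⊆ U` off which every admissible state `(t₀, δ₀, T₀)` is
generic: every `P i` holding at `(t₀, T₀)` holds at every `(t, δ, T)`. `M` is the union, over the centres
`c` of a countable subcover by dichotomy charts and the countably many `(i, T')`, of the closures of the
nowhere-dense loci based at `(c, T')`; off `M`, fullness at `t₀` (`full_of_generic`) propagates
everywhere (`propagate_of_full`). [cite: Deligne1972WeilK3, Prop. 7.5] [cite: Andre1992, §4 Lemma 4]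
[cite: Klingler2022HodgeICM, §2.6] -/
theorem isMeagre_nonGeneric_of_lociDichotomy [LocallyPathConnectedSpace U] [SecondCountableTopology U]
    [∀ x : U, Module.Finite ℚ (singularCohomology ℚ ℚ (ComplexPoints (fiberOver f
      (Subtype.val x))) k)] (s : U)
    (hrat : ∀ (x y : U) (γ : Path.Homotopic.Quotient x y) (α : complexBetti (fiberOver f x.1) k),
      IsRationalClass α → IsRationalClass (transportFun f k hU γ α))
    {ι : Type*} [Countable ι] (P : ι → ∀ t : U, (singularCohomology ℚ ℚ (ComplexPoints (fiberOver f
      (Subtype.val s))) k ≃ₗ[ℚ]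
      singularCohomology ℚ ℚ (ComplexPoints (fiberOver f (Subtype.val t))) k) → Prop)
    (hloc : ∀ (t₁ : U), ∀ N ∈ 𝓝 t₁, ∃ W : Set U, IsOpen W ∧ t₁ ∈ W ∧ W ⊆ N ∧ IsPathConnected W ∧
      ∀ (i : ι) (x : U), x ∈ W → ∀ (Tx : singularCohomology ℚ ℚ (ComplexPoints (fiberOver f (Subtype.val s))) k ≃ₗ[ℚ]
        singularCohomology ℚ ℚ (ComplexPoints (fiberOver f (Subtype.val x))) k),
        (∃ δ : Path.Homotopic.Quotient s x,
          ∀ v, ofRatClass _ k (Tx v) = transportFun f k hU δ (ofRatClass _ k v)) →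
        (∀ t ∈ W, ∀ (ε : Path x t), (∀ r, ε r ∈ W) → ∀ (T : singularCohomology ℚ ℚ (ComplexPoints (fiberOver f
          (Subtype.val s))) k ≃ₗ[ℚ]
          singularCohomology ℚ ℚ (ComplexPoints (fiberOver f (Subtype.val t))) k),
          (∀ v, ofRatClass _ k (T v) = transportFun f k hU ⟦ε⟧ (ofRatClass _ k (Tx v))) →
            P i t T) ∨
        IsNowhereDense {t : U | t ∈ W ∧ ∀ (ε : Path x t), (∀ r, ε r ∈ W) →
          ∀ (T : singularCohomology ℚ ℚ (ComplexPoints (fiberOver f (Subtype.val s))) k ≃ₗ[ℚ]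
            singularCohomology ℚ ℚ (ComplexPoints (fiberOver f (Subtype.val t))) k),
          (∀ v, ofRatClass _ k (T v) = transportFun f k hU ⟦ε⟧ (ofRatClass _ k (Tx v))) →
            P i t T}) :
    ∃ M : Set U, IsMeagre M ∧ ∀ t₀ ∉ M, ∀ (δ₀ : Path.Homotopic.Quotient s t₀)
      (T₀ : singularCohomology ℚ ℚ (ComplexPoints (fiberOver f (Subtype.val s))) k ≃ₗ[ℚ]
        singularCohomology ℚ ℚ (ComplexPoints (fiberOver f (Subtype.val t₀))) k),
      (∀ v, ofRatClass _ k (T₀ v) = transportFun f k hU δ₀ (ofRatClass _ k v)) →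
      ∀ i, P i t₀ T₀ → ∀ (t : U) (δ : Path.Homotopic.Quotient s t) (T : singularCohomology ℚ ℚ (ComplexPoints
        (fiberOver f (Subtype.val s))) k ≃ₗ[ℚ]
        singularCohomology ℚ ℚ (ComplexPoints (fiberOver f (Subtype.val t))) k),
        (∀ v, ofRatClass _ k (T v) = transportFun f k hU δ (ofRatClass _ k v)) → P i t T := by
  classical
  -- Step 1: charts `W ⊆ B` (path-connected opens inside trivialising opens) around every point
  have hchart : ∀ t₁ : U, ∃ (W : Set U) (B : Set (ComplexPoints S)), IsOpen W ∧ t₁ ∈ W ∧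
      IsPathConnected W ∧ IsOpen B ∧ B ⊆ U ∧ (∀ t ∈ W, (t : ComplexPoints S) ∈ B) ∧
      (∀ ⦃z⦄ (hz : z ∈ B), Function.Bijective (fiberRestrict f hz k)) ∧
      ∀ (i : ι) (x : U), x ∈ W → ∀ (Tx : singularCohomology ℚ ℚ (ComplexPoints (fiberOver f (Subtype.val s))) k ≃ₗ[ℚ]
        singularCohomology ℚ ℚ (ComplexPoints (fiberOver f (Subtype.val x))) k),
        (∃ δ : Path.Homotopic.Quotient s x,
          ∀ v, ofRatClass _ k (Tx v) = transportFun f k hU δ (ofRatClass _ k v)) →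
        (∀ t ∈ W, ∀ (ε : Path x t), (∀ r, ε r ∈ W) → ∀ (T : singularCohomology ℚ ℚ (ComplexPoints (fiberOver f
          (Subtype.val s))) k ≃ₗ[ℚ]
          singularCohomology ℚ ℚ (ComplexPoints (fiberOver f (Subtype.val t))) k),
          (∀ v, ofRatClass _ k (T v) = transportFun f k hU ⟦ε⟧ (ofRatClass _ k (Tx v))) →
            P i t T) ∨
        IsNowhereDense {t : U | t ∈ W ∧ ∀ (ε : Path x t), (∀ r, ε r ∈ W) →
          ∀ (T : singularCohomology ℚ ℚ (ComplexPoints (fiberOver f (Subtype.val s))) k ≃ₗ[ℚ]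
            singularCohomology ℚ ℚ (ComplexPoints (fiberOver f (Subtype.val t))) k),
          (∀ v, ofRatClass _ k (T v) = transportFun f k hU ⟦ε⟧ (ofRatClass _ k (Tx v))) →
            P i t T} := by
    intro t₁
    obtain ⟨B, hBo, ht₁B, -, hBU, hbij⟩ := hU.exists_nhds_bijective t₁.2 Set.univ Filter.univ_mem
    have hN : (Subtype.val ⁻¹' B : Set U) ∈ 𝓝 t₁ :=
      (hBo.preimage continuous_subtype_val).mem_nhds ht₁B
    obtain ⟨W, hWo, ht₁W, hWN, hWpc, hW⟩ := hloc t₁ _ hN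
    exact ⟨W, B, hWo, ht₁W, hWpc, hBo, hBU, fun t ht ↦ hWN ht, fun z hz ↦ hbij k hz, hW⟩
  choose Wp Bp hWo ht₁W hWpc hBo hBU hWB hbij hdichp using hchart
  -- Step 2: a countable subcover
  obtain ⟨Cset, hCc, hCU⟩ := TopologicalSpace.isOpen_iUnion_countable Wp hWo
  have hcov : ∀ t : U, ∃ c : Cset, t ∈ Wp c.1 := by
    intro t
    have ht : t ∈ ⋃ i ∈ Cset, Wp i := by
      rw [hCU]
      exact Set.mem_iUnion.2 ⟨t, ht₁W t⟩
    obtain ⟨i, hi⟩ := Set.mem_iUnion.1 ht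
    obtain ⟨hi, hti⟩ := Set.mem_iUnion.1 hi
    exact ⟨⟨i, hi⟩, hti⟩
  haveI : Countable Cset := hCc.to_subtype
  haveI : ∀ x : U, Countable (singularCohomology ℚ ℚ (ComplexPoints (fiberOver f (Subtype.val s))) k ≃ₗ[ℚ]
    singularCohomology ℚ ℚ (ComplexPoints (fiberOver f (Subtype.val x))) k) := fun x ↦ countable_linearEquiv_rat _ _
  -- Step 3: the loci based at the centres, and the Baire argument
  obtain ⟨L, hL⟩ : ∃ L : ∀ (c : Cset) (i : ι), (singularCohomology ℚ ℚ (ComplexPoints (fiberOver f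
    (Subtype.val s))) k ≃ₗ[ℚ]
    singularCohomology ℚ ℚ (ComplexPoints (fiberOver f (Subtype.val c.1))) k) → Set U,
      ∀ c i T', L c i T' = {t : U | t ∈ Wp c.1 ∧ ∀ (ε : Path c.1 t), (∀ r, ε r ∈ Wp c.1) →
        ∀ (T : singularCohomology ℚ ℚ (ComplexPoints (fiberOver f (Subtype.val s))) k ≃ₗ[ℚ]
          singularCohomology ℚ ℚ (ComplexPoints (fiberOver f (Subtype.val t))) k),
        (∀ v, ofRatClass _ k (T v) = transportFun f k hU ⟦ε⟧ (ofRatClass _ k (T' v))) →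
          P i t T} := ⟨_, fun _ _ _ ↦ rfl⟩
  obtain ⟨F, hF⟩ : ∃ F : (Σ c : Cset, ι × (singularCohomology ℚ ℚ (ComplexPoints (fiberOver f
    (Subtype.val s))) k ≃ₗ[ℚ]
    singularCohomology ℚ ℚ (ComplexPoints (fiberOver f (Subtype.val c.1))) k)) → Set U,
      ∀ q, F q = {t : U | IsNowhereDense (L q.1 q.2.1 q.2.2) → t ∉ closure (L q.1 q.2.1 q.2.2)} :=
    ⟨_, fun _ ↦ rfl⟩
  -- the exceptional set: the closures of the nowhere-dense loci (countably many)
  refine ⟨⋃ q, (F q)ᶜ, isMeagre_iUnion fun q ↦ ?_, ?_⟩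
  · by_cases hq : IsNowhereDense (L q.1 q.2.1 q.2.2)
    · have h : (F q)ᶜ = closure (L q.1 q.2.1 q.2.2) := by
        rw [hF, Set.compl_def]
        exact Set.ext fun t ↦ ⟨fun ht ↦ not_not.1 fun h ↦ ht fun _ ↦ h, fun ht h ↦ h hq ht⟩
      rw [h]
      exact hq.closure.isMeagre
    · have h : (F q)ᶜ = ∅ := by
        rw [hF, Set.compl_def]
        exact Set.eq_empty_of_forall_notMem fun t ht ↦ ht fun h ↦ (hq h).elim
      rw [h]
      exact IsMeagre.empty
  intro t₀ ht₀ δ₀ T₀ hT₀ i hP t δ T hT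
  -- Step 4: `t₀` lies off the closure of every nowhere-dense locus based at a centre
  have hgen : ∀ (c : Cset) (T' : singularCohomology ℚ ℚ (ComplexPoints (fiberOver f (Subtype.val s))) k ≃ₗ[ℚ]
    singularCohomology ℚ ℚ (ComplexPoints (fiberOver f (Subtype.val c.1))) k),
      IsNowhereDense (L c i T') → t₀ ∉ closure (L c i T') := by
    intro c T' hnd
    have h : t₀ ∈ F ⟨c, i, T'⟩ := by
      by_contra hc
      exact ht₀ (Set.mem_iUnion.2 ⟨⟨c, i, T'⟩, hc⟩)
    rw [hF] at h
    exact h hnd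
  -- Step 5: fullness at `t₀` in every chart through it, then propagation
  have hfull₀ : ∀ c : Cset, t₀ ∈ Wp c.1 → ∀ t' ∈ Wp c.1, ∀ (ε : Path t₀ t'), (∀ r, ε r ∈ Wp c.1) →
      ∀ (T' : singularCohomology ℚ ℚ (ComplexPoints (fiberOver f (Subtype.val s))) k ≃ₗ[ℚ]
        singularCohomology ℚ ℚ (ComplexPoints (fiberOver f (Subtype.val t'))) k),
      (∀ v, ofRatClass _ k (T' v) = transportFun f k hU ⟦ε⟧ (ofRatClass _ k (T₀ v))) → P i t' T' := by
    intro c hc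
    refine full_of_generic f k hU s hrat (P i) (hWpc c.1) (hBo c.1) (hbij c.1) (hWB c.1)
      (ht₁W c.1) hc hT₀ hP (fun T' ↦ ?_) (fun T' hT' ↦ hdichp c.1 i c.1 (ht₁W c.1) T' hT')
    simpa only [hL] using hgen c T'
  exact propagate_of_full f k hU s hrat (P i) (Module.finBasis ℚ (singularCohomology ℚ ℚ (ComplexPoints
    (fiberOver f (Subtype.val s))) k))
    (fun c : Cset ↦ Wp c.1) (fun c ↦ Bp c.1) (fun c ↦ hWo c.1) (fun c ↦ hWpc c.1)
    (fun c ↦ hBo c.1) (fun c ↦ hBU c.1) (fun c ↦ hbij c.1) (fun c ↦ hWB c.1) hcov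
    (fun c x hx Tx hTx ↦ hdichp c.1 i x hx Tx hTx) hT₀ hfull₀ δ T hT

end Generic

end HodgeTheory

end Literature.AlgebraicGeometry.HodgeTheory

end
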